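import Summits.CriticalPhenomena.PercolationContinuityZ3.Theorems.PercNearOneGluingNoHeavyLowerTailSahiCombMixSingleOrAll
import Summits.CriticalPhenomena.PercolationContinuityZ3.Theorems.PercNearOneGluingNoHeavyLowerTailSahiCombMixMixedFour

/-!
# The comb hierarchy for Sahi's `E_k`, LXXII: **THE MIXED SINGLE-COORDINATE STEP FOR EVERY `n`** — one fresh coordinate OR-ed into at most ONE member and AND-ed
# into ANY other members preserves the hereditary comb class; every number of common-order monotone decision lists with ≤ 1 accepting literal per coordinate

Support file of the one-cut programme (crux `NoHeavyLowerTail`, stmt-CriticalPhenomena-4575; cell `prim-masterthm`, seat P3, gen 11;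
`run/shared/lean/prim/prim-masterthm/prim-masterthm-p3/HIERARCHY.md` §19(i)–(k), memo `run/shared/lean/prim/prim-masterthm/FROM-prim-masterthm-p3-g11-SINGLE-MEMBER-OR.md` §6, §8).
Continues `…SahiCombMixSingleOrAll` (the single-member OR step for every `n`).  For `orAndCoord U e (sel i) G₂` (`{e ∈ ω}` OR-ed into `U_i`, AND-ed into the members
`G₂`, `G₂ i = false`) a slot of a row is AND-type (its index set contains an AND-ed member: slot `= (⋂_{l∈K∖i} U_l) ∩ {e∈ω}`, `slotSet_and`), OR-TOUCHED (`i ∈ K`, no AND-ed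
member: the slot of the pure single-OR family, `slotSet_noAnd`) or plain.  The touched-set recursion of `…SingleOrAll` peels OR-touched slots: the defect set
`Φ_x ⊆ {e ∉ ω}` also misses every AND-type slot, so with ANY other active slot present the recursion has all signs plus (`ex_phi_prod_mixed`); induction on the number
of OR-touched slots with two bases — no OR-touched slot: a row of the AND-ed family `andCoord U e G₂` (`rowFam_noOr_eq_andCoord`, gen 9's `combHereditary_andCoord`); no
AND-type slot: a row of the single-OR family (`rowFam_eq_orCoord_of_noAnd`, `combHereditary_orCoord_sel`).
* **`combHereditary_orAndCoord_sel`** — `CombHereditary U → CombHereditary (orAndCoord U e (sel i) G₂)` (`G₂ i = false`), EVERY `n`; with `…MixAnd` (no OR) and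
  **`combHereditary_grow₂_single`**: families grown by mixed steps on fresh coordinates, each OR-ing into ≤ 1 member and AND-ing into any others, stay `CombHereditary`;
  **`combHereditary_decisionList_single`** — for EVERY `n`, every `n`-tuple of common-order monotone read-once decision lists in which each coordinate is an ACCEPTING
  literal of at most one list is hereditarily comb-positive (gen 10: all quadruples, any literals).
HONEST FRAMING: a closure property of the hereditary comb class; nothing here asserts (M⁺-k) or `C_k` for `k ≥ 3`. [this work]
-/

noncomputable section

open scoped Classical

namespace Summit.CriticalPhenomena.PercolationContinuityZ3.Theorems

open Finset Function
open Literature.Combinatorics.Sahi2008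
open Literature.Probability.Percolation (DeterminedBy determinedBy_iff determinedBy_univ)
open Literature.Probability.Percolation.BHK2006 (ind_le_one ind_inter)
open Literature.Probability.Percolation.DecisionTree (ind ind_of_mem ind_of_not_mem ind_nonneg)
open SahiComb
open SahiCombDisjunct (orCoord)
open SahiCombHereditary (CombHereditary andCoord combHereditary_andCoord)
open scoped Nat

variable {ι : Type} [Fintype ι]

namespace SahiCombMix

section Mixed

variable {n : ℕ} (U : Fin n → Set (Set ι)) (e : ι) (i : Fin n) (G₂ : Fin n → Bool) (hG : G₂ i = false)
  (hUe : ∀ (j : Fin n) (b : Bool), secAt e b (U j) = U j)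

/-! ### Slots of the mixed family -/

omit [Fintype ι] in
include hG in
/-- Over an index set WITHOUT AND-ed members the mixed members are the single-OR members. [this work] -/
theorem slotSet_noAnd (K : Finset (Fin n)) (h : ∀ l ∈ K, l ≠ i → G₂ l = false) :
    (⋂ l ∈ K, orAndCoord U e (sel i) G₂ l) = ⋂ l ∈ K, orCoord U e (sel i) l := by
  refine Set.iInter_congr fun l => Set.iInter_congr fun hl => ?_
  unfold orAndCoord SahiCombDisjunct.orCoord
  by_cases hli : l = i
  · subst hli; simp [sel]
  · have h2 := h l hl hli
    simp [sel, hli, h2]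

omit [Fintype ι] in
include hG in
/-- Over an index set WITH an AND-ed member the mixed member is `(⋂_{l∈K∖i} U_l) ∩ {e ∈ ω}` (the OR part of `U_i` is absorbed). [this work] -/
theorem slotSet_and (K : Finset (Fin n)) (h : ∃ l ∈ K, G₂ l = true) :
    (⋂ l ∈ K, orAndCoord U e (sel i) G₂ l) = (⋂ l ∈ K.erase i, U l) ∩ {ω : Set ι | e ∈ ω} := by
  obtain ⟨l₀, hl₀, hG₀⟩ := h
  have hl₀i : l₀ ≠ i := fun h' => by rw [h', hG] at hG₀; exact Bool.false_ne_true hG₀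
  have hcond : ¬ ∀ l ∈ K, sel i l = true ∨ G₂ l = false := fun hall => by
    rcases hall l₀ hl₀ with h1 | h2
    · exact hl₀i (by simpa [sel] using h1)
    · rw [hG₀] at h2; exact Bool.noConfusion h2
  have hfilt : K.filter (fun l => sel i l = false) = K.erase i := by
    ext l; simp [sel, Finset.mem_erase, and_comm]
  rw [biInter_orAndCoord_eq_mixCoord, hfilt]
  unfold lowerEv
  rw [if_neg hcond]
  ext ω
  simp only [mem_mixCoord, Set.mem_empty_iff_false, false_or, Set.mem_inter_iff, Set.mem_setOf_eq]
  exact and_comm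

omit [Fintype ι] in
include hG in
/-- The defect set of an OR-touched slot misses every AND-type slot. [this work] -/
theorem phi_inter_slot_and (K K' : Finset (Fin n)) (h : ∃ l ∈ K', G₂ l = true) :
    (((⋂ l ∈ K.erase i, U l) \ U i) ∩ {ω : Set ι | e ∉ ω}) ∩ (⋂ l ∈ K', orAndCoord U e (sel i) G₂ l) = ∅ := by
  rw [slotSet_and U e i G₂ hG K' h]
  exact Set.eq_empty_iff_forall_notMem.2 fun ω hω => hω.1.2 hω.2.2

/-! ### Rows without OR-touched slots are rows of the AND-ed family -/

omit [Fintype ι] in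
/-- The coordinate factor of an index set of `andCoord`. [this work] -/
theorem biInter_coordFactor (L : Finset (Fin n)) :
    (⋂ l ∈ L, (bif G₂ l then {ω : Set ι | e ∈ ω} else Set.univ)) = if ∃ l ∈ L, G₂ l = true then {ω : Set ι | e ∈ ω} else Set.univ := by
  ext ω
  simp only [Set.mem_iInter]
  split_ifs with h
  · constructor
    · intro hω; obtain ⟨l, hl, hGl⟩ := h; simpa [hGl] using hω l hl
    · intro hω l hl; cases G₂ l <;> simp [hω]
  · have h' : ∀ l ∈ L, G₂ l = false := fun l hl => by
      cases hGl : G₂ l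
      · rfl
      · exact absurd ⟨l, hl, hGl⟩ h
    constructor
    · intro _; exact Set.mem_univ _
    · intro _ l hl; simp [h' l hl]

omit [Fintype ι] in
include hG in
/-- **A row of the mixed family WITHOUT OR-touched slots is a row of `andCoord U e G₂`** (slot map `K_j ∖ i`). [this work] -/
theorem rowFam_noOr_eq_andCoord {m : ℕ} (K : Fin m → Finset (Fin n)) (h : ∀ j, i ∈ K j → ∃ l ∈ K j, G₂ l = true) :
    (fun j => ind (⋂ l ∈ K j, orAndCoord U e (sel i) G₂ l)) = fun j => ind (⋂ l ∈ (K j).erase i, andCoord U e G₂ l) := by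
  funext j
  congr 1
  rw [SahiCombHereditary.biInter_andCoord, biInter_coordFactor]
  by_cases hA : ∃ l ∈ K j, G₂ l = true
  · have hA' : ∃ l ∈ (K j).erase i, G₂ l = true := by
      obtain ⟨l, hl, hGl⟩ := hA
      exact ⟨l, Finset.mem_erase.2 ⟨fun h' => by rw [h', hG] at hGl; exact Bool.false_ne_true hGl, hl⟩, hGl⟩
    rw [slotSet_and U e i G₂ hG (K j) hA, if_pos hA']
  · have hi : i ∉ K j := fun hi => hA (h j hi)
    have hA' : ¬ ∃ l ∈ (K j).erase i, G₂ l = true := fun ⟨l, hl, hGl⟩ => hA ⟨l, Finset.mem_of_mem_erase hl, hGl⟩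
    rw [if_neg hA', Set.inter_univ, Finset.erase_eq_of_notMem hi,
      slotSet_noAnd U e i G₂ hG (K j) (fun l hl _ => by
        cases hGl : G₂ l
        · rfl
        · exact absurd ⟨l, hl, hGl⟩ hA),
      slotSet_untouched U e i (K j) hi]

omit [Fintype ι] in
include hG in
/-- A row of the mixed family WITHOUT AND-type slots is a row of the single-OR family. [this work] -/
theorem rowFam_eq_orCoord_of_noAnd {m : ℕ} (K : Fin m → Finset (Fin n)) (h : ∀ j, ∀ l ∈ K j, l ≠ i → G₂ l = false) :
    (fun j => ind (⋂ l ∈ K j, orAndCoord U e (sel i) G₂ l)) = fun j => ind (⋂ l ∈ K j, orCoord U e (sel i) l) := by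
  funext j; rw [slotSet_noAnd U e i G₂ hG (K j) (h j)]

/-! ### The defect moments in the mixed family -/

include hG hUe in
/-- **Defect moments, mixed family**: for an OR-touched slot `x` and a set `T` of other slots, `E_p[1_{Φ_x}·Π_{j∈T} 1_{slot_j}]` vanishes if `T` contains an ACTIVE slot
(OR-touched or AND-type) and equals `(1 − p_e)·μ_p((Q_x ∩ Q_T) ∖ U_i)` otherwise. [this work] -/
theorem ex_phi_prod_mixed {m : ℕ} (K : Fin (m + 1) → Finset (Fin n)) (x : Fin (m + 1)) (T : Finset (Fin m)) (p : ι → unitInterval) :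
    ex (bernoulliWeight p) (ind ((((⋂ l ∈ (K x).erase i, U l) \ U i) ∩ {ω : Set ι | e ∉ ω}))
        * ∏ j ∈ T, ind (⋂ l ∈ K (x.succAbove j), orAndCoord U e (sel i) G₂ l))
      = if ∃ y ∈ T, (i ∈ K (x.succAbove y) ∨ ∃ l ∈ K (x.succAbove y), G₂ l = true) then 0 else
        (1 - (p e : ℝ)) * (ex (bernoulliWeight p) (ind ((⋂ l ∈ (K x).erase i, U l) ∩ ⋂ j ∈ T, ⋂ l ∈ K (x.succAbove j), U l))
          - ex (bernoulliWeight p) (ind (U i ∩ ((⋂ l ∈ (K x).erase i, U l) ∩ ⋂ j ∈ T, ⋂ l ∈ K (x.succAbove j), U l)))) := by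
  rw [finsetProd_ind_eq_ind_biInter (fun j => ⋂ l ∈ K (x.succAbove j), orAndCoord U e (sel i) G₂ l) T,
    show ind ((((⋂ l ∈ (K x).erase i, U l) \ U i) ∩ {ω : Set ι | e ∉ ω}))
        * ind (⋂ j ∈ T, ⋂ l ∈ K (x.succAbove j), orAndCoord U e (sel i) G₂ l)
      = ind (((((⋂ l ∈ (K x).erase i, U l) \ U i) ∩ {ω : Set ι | e ∉ ω})) ∩ ⋂ j ∈ T, ⋂ l ∈ K (x.succAbove j), orAndCoord U e (sel i) G₂ l)
      from by funext ω; rw [Pi.mul_apply]; exact (ind_inter _ _ ω).symm]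
  split_ifs with hT
  · obtain ⟨y, hyT, hy⟩ := hT
    have hsub : (((⋂ l ∈ (K x).erase i, U l) \ U i) ∩ {ω : Set ι | e ∉ ω}) ∩ (⋂ j ∈ T, ⋂ l ∈ K (x.succAbove j), orAndCoord U e (sel i) G₂ l)
        ⊆ (((⋂ l ∈ (K x).erase i, U l) \ U i) ∩ {ω : Set ι | e ∉ ω}) ∩ (⋂ l ∈ K (x.succAbove y), orAndCoord U e (sel i) G₂ l) :=
      Set.inter_subset_inter_right _ fun ω hω => (Set.mem_iInter₂.1 hω) y hyT
    have hempty : (((⋂ l ∈ (K x).erase i, U l) \ U i) ∩ {ω : Set ι | e ∉ ω}) ∩ (⋂ l ∈ K (x.succAbove y), orAndCoord U e (sel i) G₂ l) = ∅ := by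
      by_cases hA : ∃ l ∈ K (x.succAbove y), G₂ l = true
      · exact phi_inter_slot_and U e i G₂ hG (K x) _ hA
      · have hiy : i ∈ K (x.succAbove y) := hy.resolve_right hA
        rw [slotSet_noAnd U e i G₂ hG _ (fun l hl _ => by
          cases hGl : G₂ l
          · rfl
          · exact absurd ⟨l, hl, hGl⟩ hA)]
        exact phi_inter_slot_touched U e i (K x) _ hiy
    rw [hempty, Set.subset_empty_iff] at hsub
    rw [hsub, ind_empty_fun, ex_zero_fun]
  · have hun : ∀ y ∈ T, i ∉ K (x.succAbove y) ∧ ∀ l ∈ K (x.succAbove y), l ≠ i → G₂ l = false := by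
      intro y hy
      refine ⟨fun hi => hT ⟨y, hy, Or.inl hi⟩, fun l hl _ => ?_⟩
      cases hGl : G₂ l
      · rfl
      · exact absurd ⟨y, hy, Or.inr ⟨l, hl, hGl⟩⟩ hT
    have hV : (⋂ j ∈ T, ⋂ l ∈ K (x.succAbove j), orAndCoord U e (sel i) G₂ l) = ⋂ j ∈ T, ⋂ l ∈ K (x.succAbove j), U l :=
      Set.iInter_congr fun j => Set.iInter_congr fun hj => by
        rw [slotSet_noAnd U e i G₂ hG _ (hun j hj).2, slotSet_untouched U e i _ (hun j hj).1]
    rw [hV]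
    have hA : ∀ b : Bool, secAt e b (⋂ j ∈ T, ⋂ l ∈ K (x.succAbove j), U l) = ⋂ j ∈ T, ⋂ l ∈ K (x.succAbove j), U l := by
      intro b
      rw [secAt_biInter_fam]
      exact Set.iInter_congr fun j => Set.iInter_congr fun _ => secAt_biInter U e hUe _ b
    exact ex_ind_phi_inter U e i hUe (K x) _ hA p

/-! ### The mixed single-coordinate step -/

include hG hUe in
/-- **Induction on the number of OR-touched slots** (AND-type slots allowed): every row of the mixed family is comb-positive at multidegree equal to its order.
[this work] -/
theorem combPos_rowFamMixed_of_card_le (hU : CombHereditary U) :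
    ∀ (o m : ℕ) (K : Fin m → Finset (Fin n)), (univ.filter fun j => i ∈ K j ∧ ∀ l ∈ K j, l ≠ i → G₂ l = false).card ≤ o →
      CombPos (fun _ : ι => m) (fun p => sahiE (bernoulliWeight p) m (fun j => ind (⋂ l ∈ K j, orAndCoord U e (sel i) G₂ l))) := by
  intro o
  induction o with
  | zero =>
    intro m K hk
    have h0 : ∀ j, i ∈ K j → ∃ l ∈ K j, G₂ l = true := by
      intro j hj
      by_contra hne
      have hall : ∀ l ∈ K j, l ≠ i → G₂ l = false := fun l hl _ => by
        cases hGl : G₂ l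
        · rfl
        · exact absurd ⟨l, hl, hGl⟩ hne
      have : j ∈ univ.filter fun j => i ∈ K j ∧ ∀ l ∈ K j, l ≠ i → G₂ l = false := Finset.mem_filter.2 ⟨Finset.mem_univ _, hj, hall⟩
      rw [Finset.card_eq_zero.1 (Nat.le_zero.1 hk)] at this
      exact Finset.notMem_empty _ this
    rw [rowFam_noOr_eq_andCoord U e i G₂ hG K h0]
    exact combHereditary_andCoord U e G₂ hUe hU m (fun j => (K j).erase i)
  | succ o ih =>
    intro m K hk
    by_cases hle : (univ.filter fun j => i ∈ K j ∧ ∀ l ∈ K j, l ≠ i → G₂ l = false).card ≤ o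
    · exact ih m K hle
    have hcard : (univ.filter fun j => i ∈ K j ∧ ∀ l ∈ K j, l ≠ i → G₂ l = false).card = o + 1 := by omega
    obtain ⟨x, hx⟩ : ∃ x, x ∈ univ.filter fun j => i ∈ K j ∧ ∀ l ∈ K j, l ≠ i → G₂ l = false := Finset.card_pos.1 (by omega)
    have hxi : i ∈ K x := (Finset.mem_filter.1 hx).2.1
    have hxn : ∀ l ∈ K x, l ≠ i → G₂ l = false := (Finset.mem_filter.1 hx).2.2
    obtain ⟨m', rfl⟩ : ∃ m', m = m' + 1 := ⟨m - 1, (Nat.succ_pred_eq_of_pos (Fin.pos x)).symm⟩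
    have hothers : (univ.filter fun y : Fin m' => i ∈ K (x.succAbove y) ∧ ∀ l ∈ K (x.succAbove y), l ≠ i → G₂ l = false).card = o := by
      have := card_filter_succAbove (fun j => i ∈ K j ∧ ∀ l ∈ K j, l ≠ i → G₂ l = false) x ⟨hxi, hxn⟩
      omega
    by_cases hact : ∃ y : Fin m', i ∈ K (x.succAbove y) ∨ ∃ l ∈ K (x.succAbove y), G₂ l = true
    · -- another active slot: the recursion
      obtain ⟨y₀, hy₀⟩ := hact
      set F : Fin (m' + 1) → Set ι → ℝ := fun j => ind (⋂ l ∈ K j, orAndCoord U e (sel i) G₂ l) with hF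
      set Q : Set (Set ι) := ⋂ l ∈ (K x).erase i, U l with hQ
      set Φ : Set (Set ι) := (Q \ U i) ∩ {ω : Set ι | e ∉ ω} with hΦ
      have hslotx : ind (⋂ l ∈ K x, orAndCoord U e (sel i) G₂ l) = ind Q - ind Φ := by
        rw [slotSet_noAnd U e i G₂ hG (K x) hxn, ind_slot_touched U e i (K x) hxi]
      -- `x` made plain: `o` OR-touched slots
      have hK' : (univ.filter fun j => i ∈ update K x ((K x).erase i) j ∧ ∀ l ∈ update K x ((K x).erase i) j, l ≠ i → G₂ l = false).card ≤ o := by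
        have h1 : (univ.filter fun j => i ∈ update K x ((K x).erase i) j ∧ ∀ l ∈ update K x ((K x).erase i) j, l ≠ i → G₂ l = false)
            ⊆ (univ.filter fun j => i ∈ K j ∧ ∀ l ∈ K j, l ≠ i → G₂ l = false).erase x := by
          intro j hj
          rw [Finset.mem_filter] at hj
          by_cases hjx : j = x
          · subst hjx; rw [update_self] at hj; exact absurd hj.2.1 (Finset.notMem_erase i _)
          · rw [update_of_ne hjx] at hj
            exact Finset.mem_erase.2 ⟨hjx, Finset.mem_filter.2 ⟨Finset.mem_univ _, hj.2⟩⟩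
        have := Finset.card_le_card h1
        rw [Finset.card_erase_of_mem hx, hcard] at this
        omega
      have ihQ := ih (m' + 1) (update K x ((K x).erase i)) hK'
      have hupd : (fun j => ind (⋂ l ∈ update K x ((K x).erase i) j, orAndCoord U e (sel i) G₂ l)) = update F x (ind Q) := by
        funext j
        by_cases hj : j = x
        · subst hj
          rw [update_self, update_self, slotSet_noAnd U e i G₂ hG _ (fun l hl hli => hxn l (Finset.mem_of_mem_erase hl) hli),
            biInter_orCoord_sel_erase]
        · rw [update_of_ne hj, update_of_ne hj]
      rw [hupd] at ihQ
      -- sub-rows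
      have ihT : ∀ T : Finset (Fin m'), CombPos (fun _ : ι => Tᶜ.card)
          (fun p => sahiE (bernoulliWeight p) Tᶜ.card (fun j => x.removeNth F (Tᶜ.orderEmbOfFin rfl j))) := by
        intro T
        have hle : (univ.filter fun j : Fin Tᶜ.card => i ∈ K (x.succAbove (Tᶜ.orderEmbOfFin rfl j))
            ∧ ∀ l ∈ K (x.succAbove (Tᶜ.orderEmbOfFin rfl j)), l ≠ i → G₂ l = false).card ≤ o := by
          rw [← hothers]
          exact SahiTotalCumulance.card_filter_comp_le_of_injective
            (fun y : Fin m' => i ∈ K (x.succAbove y) ∧ ∀ l ∈ K (x.succAbove y), l ≠ i → G₂ l = false) _ (Tᶜ.orderEmbOfFin rfl).injective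
        exact ih Tᶜ.card (fun j => K (x.succAbove (Tᶜ.orderEmbOfFin rfl j))) hle
      have hterm : ∀ T : Finset (Fin m'), CombPos (fun _ : ι => m' + 1) (fun p =>
          ((T.card)! : ℝ) * (ex (bernoulliWeight p) (ind Φ * ∏ j ∈ T, x.removeNth F j)
            * sahiE (bernoulliWeight p) Tᶜ.card (fun j => x.removeNth F (Tᶜ.orderEmbOfFin rfl j)))) := by
        intro T
        by_cases hT : ∃ y ∈ T, (i ∈ K (x.succAbove y) ∨ ∃ l ∈ K (x.succAbove y), G₂ l = true)
        · refine (CombPos.zero _).congr fun p => ?_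
          rw [show ex (bernoulliWeight p) (ind Φ * ∏ j ∈ T, x.removeNth F j) = 0 from by
            rw [hΦ, hQ, show x.removeNth F = fun j => ind (⋂ l ∈ K (x.succAbove j), orAndCoord U e (sel i) G₂ l) from rfl,
              ex_phi_prod_mixed U e i G₂ hG hUe K x T p, if_pos hT]]
          ring
        · have hA : ∀ b : Bool, secAt e b ((⋂ l ∈ (K x).erase i, U l) ∩ ⋂ j ∈ T, ⋂ l ∈ K (x.succAbove j), U l)
              = (⋂ l ∈ (K x).erase i, U l) ∩ ⋂ j ∈ T, ⋂ l ∈ K (x.succAbove j), U l := by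
            intro b
            rw [secAt_inter, secAt_biInter U e hUe _ b, secAt_biInter_fam]
            congr 1
            exact Set.iInter_congr fun j => Set.iInter_congr fun _ => secAt_biInter U e hUe _ b
          have hdiff := combPos_exDiff_off e ((⋂ l ∈ (K x).erase i, U l) ∩ ⋂ j ∈ T, ⋂ l ∈ K (x.succAbove j), U l) (U i) hA (hUe i)
          have hcT : Tᶜ.card ≤ m' := by simpa using Finset.card_le_univ Tᶜ
          refine ((((combPos_one_sub_coord e).mul hdiff).mul_of_le (ihT T) (deg_step_le e m' Tᶜ.card hcT)).smul
            (Nat.cast_nonneg _ : (0 : ℝ) ≤ ((T.card)! : ℝ))).congr fun p => ?_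
          rw [show ex (bernoulliWeight p) (ind Φ * ∏ j ∈ T, x.removeNth F j)
              = (1 - (p e : ℝ)) * (ex (bernoulliWeight p) (ind ((⋂ l ∈ (K x).erase i, U l) ∩ ⋂ j ∈ T, ⋂ l ∈ K (x.succAbove j), U l))
                - ex (bernoulliWeight p) (ind (U i ∩ ((⋂ l ∈ (K x).erase i, U l) ∩ ⋂ j ∈ T, ⋂ l ∈ K (x.succAbove j), U l)))) from by
            rw [hΦ, hQ, show x.removeNth F = fun j => ind (⋂ l ∈ K (x.succAbove j), orAndCoord U e (sel i) G₂ l) from rfl,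
              ex_phi_prod_mixed U e i G₂ hG hUe K x T p, if_neg hT]]
      have htop : ∀ p : ι → unitInterval, ex (bernoulliWeight p) (ind Φ * ∏ j, x.removeNth F j) = 0 := by
        intro p
        rw [hΦ, hQ, show x.removeNth F = fun j => ind (⋂ l ∈ K (x.succAbove j), orAndCoord U e (sel i) G₂ l) from rfl,
          ex_phi_prod_mixed U e i G₂ hG hUe K x univ p, if_pos ⟨y₀, Finset.mem_univ _, hy₀⟩]
      refine (ihQ.add (CombPos.sum (univ.filter fun T : Finset (Fin m') => T ≠ univ) fun T _ => hterm T)).congr fun p => ?_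
      have hFx : update F x ((1 : ℝ) • ind Q + (-1 : ℝ) • ind Φ) = F := by
        rw [show (1 : ℝ) • ind Q + (-1 : ℝ) • ind Φ = ind Q - ind Φ from by funext ω; simp; ring, ← hslotx]
        exact update_eq_self x F
      have hlin := sahiE_update_lin (bernoulliWeight p) (m' + 1) F x 1 (-1) (ind Q) (ind Φ)
      rw [hFx] at hlin
      rw [hlin, SahiMeetTowerAll.sahiE_update_eq_sahiE_cons (bernoulliWeight p) m' F x (ind Φ),
        SahiMomentExpansion.sahiE_cons_eq_moment_expansion_aux, htop p]
      simp only [hF, hQ, hΦ]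
      ring
    · -- no other active slot: a row of the single-OR family
      have hnoAnd : ∀ j, ∀ l ∈ K j, l ≠ i → G₂ l = false := by
        intro j l hl hli
        by_cases hj : j = x
        · subst hj; exact hxn l hl hli
        · obtain ⟨y, rfl⟩ := Fin.exists_succAbove_eq hj
          cases hGl : G₂ l
          · rfl
          · exact absurd ⟨y, Or.inr ⟨l, hl, hGl⟩⟩ hact
      rw [rowFam_eq_orCoord_of_noAnd U e i G₂ hG K hnoAnd]
      exact combHereditary_orCoord_sel U e i hUe hU (m' + 1) K

include hG hUe in
/-- **THE MIXED SINGLE-COORDINATE STEP FOR EVERY `n`**: OR-ing `{e ∈ ω}` into `U_i` and AND-ing it into the members `G₂ ∌ i` preserves `CombHereditary`. [this work] -/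
theorem combHereditary_orAndCoord_sel (hU : CombHereditary U) : CombHereditary (orAndCoord U e (sel i) G₂) :=
  fun m K => combPos_rowFamMixed_of_card_le U e i G₂ hG hUe hU _ m K le_rfl

end Mixed

/-! ### Growth by single-OR mixed steps; decision lists with at most one accepting literal per coordinate -/

section Grow

open Literature.Probability.Percolation (DeterminedBy determinedBy_iff determinedBy_univ)

omit [Fintype ι] in
/-- With no OR-member the mixed step is the AND step. [this work] -/
theorem orAndCoord_noOr {n : ℕ} (U : Fin n → Set (Set ι)) (e : ι) (G₂ : Fin n → Bool) :
    orAndCoord U e (fun _ => false) G₂ = andCoord U e G₂ := by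
  funext j; unfold orAndCoord SahiCombHereditary.andCoord; cases G₂ j <;> simp

/-- **GROWING `n` EVENTS BY SINGLE-OR MIXED STEPS**: a `CombHereditary` family determined by `S`, grown by mixed steps `(e, G₁, G₂)` on pairwise distinct fresh coordinates
each of which OR-s its coordinate into at most ONE member (`G₁ = sel i` with `G₂ i = false`, or no OR at all), stays `CombHereditary` — every `n`. [this work] -/
theorem combHereditary_grow₂_single {n : ℕ} {U : Fin n → Set (Set ι)} {S : Set ι} (hUS : ∀ j, DeterminedBy (U j) S) (hU : CombHereditary U) :
    ∀ (L : List (ι × (Fin n → Bool) × (Fin n → Bool))), (L.map Prod.fst).Nodup → (∀ s ∈ L, s.1 ∉ S) →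
      (∀ s ∈ L, (∃ i, s.2.1 = sel i ∧ s.2.2 i = false) ∨ s.2.1 = fun _ => false) → CombHereditary (grow₂ U L)
  | [], _, _, _ => hU
  | s :: L, hL, hS, h1 => by
    rw [List.map_cons, List.nodup_cons] at hL
    have ih := combHereditary_grow₂_single hUS hU L hL.2 (fun t ht => hS t (List.mem_cons_of_mem s ht))
      fun t ht => h1 t (List.mem_cons_of_mem s ht)
    have hig : ∀ (j : Fin n) (b : Bool), secAt s.1 b (grow₂ U L j) = grow₂ U L j := fun j b =>
      SahiCombJunta.secAt_eq_self_of_determinedBy (determinedBy_grow₂ hUS L j) (by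
        simp only [Set.mem_union, Set.mem_setOf_eq, not_or]
        exact ⟨hS s List.mem_cons_self, hL.1⟩) b
    show CombHereditary (orAndCoord (grow₂ U L) s.1 s.2.1 s.2.2)
    rcases h1 s List.mem_cons_self with ⟨i, hi, hGi⟩ | h0
    · rw [hi]; exact combHereditary_orAndCoord_sel _ s.1 i s.2.2 hGi hig ih
    · rw [h0, orAndCoord_noOr]; exact combHereditary_andCoord _ s.1 s.2.2 hig ih

/-- **EVERY NUMBER OF COMMON-ORDER MONOTONE DECISION LISTS WITH AT MOST ONE ACCEPTING LITERAL PER COORDINATE IS HEREDITARILY COMB-POSITIVE**: from a constant start,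
any list of mixed steps with pairwise distinct coordinates, each OR-ing into ≤ 1 member, yields a `CombHereditary` family — every `n`. [this work] -/
theorem combHereditary_decisionList_single {n : ℕ} (c : Fin n → Bool) (L : List (ι × (Fin n → Bool) × (Fin n → Bool))) (hL : (L.map Prod.fst).Nodup)
    (h1 : ∀ s ∈ L, (∃ i, s.2.1 = sel i ∧ s.2.2 i = false) ∨ s.2.1 = fun _ => false) :
    CombHereditary (grow₂ (fun j => bif c j then (Set.univ : Set (Set ι)) else ∅) L) := by
  refine combHereditary_grow₂_single (S := (∅ : Set ι)) (fun j => ?_) (SahiCombHereditary.combHereditary_constFamily c) L hL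
    (fun s _ => Set.notMem_empty _) h1
  cases c j
  · rw [determinedBy_iff]; intro ω ω' _; simp
  · exact determinedBy_univ _

/-- Law-level shadow: all rows of such decision-list families are nonnegative under every product measure. [this work] -/
theorem sahiE_decisionList_single_nonneg {n : ℕ} (c : Fin n → Bool) (L : List (ι × (Fin n → Bool) × (Fin n → Bool))) (hL : (L.map Prod.fst).Nodup)
    (h1 : ∀ s ∈ L, (∃ i, s.2.1 = sel i ∧ s.2.2 i = false) ∨ s.2.1 = fun _ => false) (p : ι → unitInterval) (m : ℕ) (K : Fin m → Finset (Fin n)) :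
    0 ≤ sahiE (bernoulliWeight p) m (fun j => ind (⋂ l ∈ K j, grow₂ (fun j => bif c j then (Set.univ : Set (Set ι)) else ∅) L l)) :=
  ((combHereditary_decisionList_single c L hL h1).hereditaryAllOrders p) m K

end Grow

end SahiCombMix

end Summit.CriticalPhenomena.PercolationContinuityZ3.Theorems

end
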